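import Literature.AlgebraicGeometry.Resolution.Temkin2008LocalizationProofs
import Literature.AlgebraicGeometry.Resolution.QuasiExcellentField
import Literature.AlgebraicGeometry.Resolution.ExcellentRingsEssFiniteType
import Literature.AlgebraicGeometry.Resolution.ExcellentRingsFieldProofs
import Literature.AlgebraicGeometry.Resolution.BlowupsExistence
import Literature.AlgebraicGeometry.Resolution.BlowupsLocal
import HarnessLib

/-!
# Crux `Picover` (stmt-ResolutionOfSingularities-0554), stub `stub_picoverDegP`: Temkin's localisation
# of desingularization per scheme, and the blow-up calculus of the kernel reduction

Route `ResolutionOfSingularities/pAlteration`, crux `Picover`, line `degree-p-tower`, stub plan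
`Cruxes/Picover/STUB-PLAN-stub_picoverDegP.md` (helpers H1, H3b, H4a). Support file
(`--supports stmt-ResolutionOfSingularities-0554`); companion `PAlterationPicoverKernelReduction.lean`
assembles these into the reduction of `stub_picoverDegP` to its kernel at local dimension `≥ 4`.

* `admitsDesingularization_of_localBlowups` (H1) — Temkin 2008 Prop. 2.3.4 (iii)⇒(ii) for ONE
  integral scheme `X` of finite type over a Noetherian quasi-excellent base: if at every SINGULAR
  point `x` every blow-up `S'` of `Spec 𝒪_{X,x}` whose singular points lie over the closed point
  admits a desingularization (a `Sing`-supported blow-up with regular source), then so does `X`.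
  The proof is the in-tree Noetherian induction of `temkin2008_prop234_of_comp`
  (`Literature/AlgebraicGeometry/Resolution/Temkin2008LocalizationProofs.lean`) with the local
  hypothesis restricted to the singular points of the given scheme.
* `exists_isBlowup_factor` (H3b) — factoring a blow-up that principalizes `J` through the blow-up
  along `J` (Stacks 080A twice + uniqueness of blow-ups). (H2 and H3c of the plan are already in
  the tree: `IsRegularCentreBlowupSeq.exists_isBlowup_supported` and
  `isEffectiveCartier_of_isLocallyPrincipal_of_ne_bot`,
  `Theorems/ValuativePatchingRelPrincipalizationDimThree.lean`.)
* `isExcellent_of_locallyOfFiniteType_of_isExcellentRing`, `isExcellentRing_stalk` (H4a) —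
  excellence of schemes of finite type over an excellent ring and of the stalks of schemes locally
  of finite type over a field. [Matsumura, Commutative Algebra, §34]
* `three_le_of_not_le_two`, `le_three_of_not_four_le` — arithmetic in `WithBot ℕ∞`.

No new definitions. [folklore; cite: Temkin2008, Prop. 2.3.4; StacksProject, Tags 080A, 080E]
-/

noncomputable section

open CategoryTheory CategoryTheory.Limits AlgebraicGeometry TopologicalSpace IsLocalRing
open Literature.AlgebraicGeometry.Resolution

set_option linter.dupNamespace false -- mandated namespace of this single-conjunct summit

namespace Summit.ResolutionOfSingularities.ResolutionOfSingularities.Theorems.Picover.LocalBlowups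

universe u

/-! ## H1 — per-scheme Temkin localisation (the in-tree induction, local hypothesis at singular points only) -/

/-- **Temkin's localisation of desingularization, per scheme** (Temkin 2008, Prop. 2.3.4
(iii)⇒(ii), for one scheme). Let `X` be an integral scheme of finite type over a Noetherian
quasi-excellent scheme `B`. If for every singular point `x ∈ X` every blow-up `S'` of
`Spec 𝒪_{X,x}` whose singular points all lie over the closed point admits a desingularization
(`Scheme.AdmitsDesingularization`: a blow-up along an ideal sheaf co-supported in the singular
locus, with regular source), then `X` admits a desingularization. Proof: the Noetherian induction
of the in-tree `temkin2008_prop234_of_comp` on the closed set over which the current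
`Sing`-supported blow-up `X' → X` is still singular, using a maximal point `x` of it, the local
desingularization over `Spec 𝒪_{X,x}` (flat base change of blow-ups, extension of its centre to
`X'`, Temkin 2008 Lemma 2.1.1, composition of supported blow-ups, Lemma 2.1.4).
[cite: Temkin2008, Prop. 2.3.4] -/
theorem admitsDesingularization_of_localBlowups {B X : Scheme.{u}} [IsNoetherian B]
    (hB : Scheme.IsQuasiExcellent B) (f₀ : X ⟶ B) [IsIntegral X] [LocallyOfFiniteType f₀]
    [QuasiCompact f₀]
    (hloc : ∀ x : X, x ∉ Scheme.regularLocus X → ∀ (S' : Scheme.{u})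
      (g : S' ⟶ Spec (X.presheaf.stalk x)) (I : (Spec (X.presheaf.stalk x)).IdealSheafData),
      IsBlowup g I →
      (∀ s : S', s ∉ Scheme.regularLocus S' → g s = closedPoint (X.presheaf.stalk x)) →
      Scheme.AdmitsDesingularization S') :
    Scheme.AdmitsDesingularization X := by
  -- `X` is a Noetherian scheme, its singular locus `T` is closed
  haveI : IsLocallyNoetherian X := LocallyOfFiniteType.isLocallyNoetherian f₀
  haveI : CompactSpace X := QuasiCompact.compactSpace_of_compactSpace f₀
  haveI : IsNoetherian X := {}
  set T : Set X := (Scheme.regularLocus X)ᶜ with hT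
  have hTc : IsClosed T := isClosed_compl_regularLocus_of_locallyOfFiniteType f₀ hB
  -- the induction statement
  suffices H : ∀ C : Closeds X, (C : Set X) ⊆ T →
      (∃ (X' : Scheme.{u}) (f : X' ⟶ X) (J : X.IdealSheafData), IsBlowup f J ∧
        (J.support : Set X) ⊆ T ∧ ∀ x' : X', f x' ∉ C → x' ∈ Scheme.regularLocus X') →
      Scheme.AdmitsDesingularization X by
    refine H ⟨T, hTc⟩ subset_rfl ⟨X, 𝟙 X, ⊤, isBlowup_id_top X, ?_, fun x' hx' => ?_⟩
    · simp [Scheme.IdealSheafData.support_top]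
    · simpa [hT] using hx'
  intro C
  induction C using WellFoundedLT.induction with
  | ind C ih =>
  intro hCT ⟨X', f, J, hf, hJ, hreg⟩
  -- either `X'` is already regular …
  by_cases hall : ∀ x' : X', x' ∈ Scheme.regularLocus X'
  · exact ⟨X', f, ⟨J, hf, hJ⟩, fun x' => (Scheme.mem_regularLocus x').mp (hall x')⟩
  -- … or `C` is nonempty; pick a maximal point `x` of `C`
  push Not at hall
  obtain ⟨x₁, hx₁⟩ := hall
  have hx₁C : f x₁ ∈ (C : Set X) := by
    by_contra h
    exact hx₁ (hreg x₁ h)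
  obtain ⟨x, hxC, hmax⟩ := exists_maximal_point_of_isClosed C.isClosed hx₁C
  -- `X'` is Noetherian, of finite type over `k`
  haveI : IsProper f := hf.isProper
  haveI : IsLocallyNoetherian X' := LocallyOfFiniteType.isLocallyNoetherian f
  haveI : CompactSpace X' := QuasiCompact.compactSpace_of_compactSpace f
  haveI : IsNoetherian X' := {}
  -- the local scheme `S = Spec 𝒪_{X,x}` and the pro-open pro-subscheme `S' = X' ×_X S` of `X'`
  haveI : Flat (X.fromSpecStalk x) := flat_fromSpecStalk X x
  haveI : IsNoetherian (pullback f (X.fromSpecStalk x)) := {}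
  have hgb : IsBlowup (pullback.snd f (X.fromSpecStalk x)) (J.comap (X.fromSpecStalk x)) :=
    hf.pullback_snd_of_flat (X.fromSpecStalk x)
  have hfj : ∀ s : ↑(pullback f (X.fromSpecStalk x)),
      f (pullback.fst f (X.fromSpecStalk x) s) =
        X.fromSpecStalk x (pullback.snd f (X.fromSpecStalk x) s) := fun s => by
    rw [← Scheme.Hom.comp_apply, pullback.condition, Scheme.Hom.comp_apply]
  -- `S'_sing ⊆ g⁻¹(s)`: a singular point of `S'` is singular in `X'`, hence lies over `C`, over a
  -- generization of `x`, hence over `x` by maximality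
  have hsing : ∀ s : ↑(pullback f (X.fromSpecStalk x)),
      s ∉ Scheme.regularLocus (pullback f (X.fromSpecStalk x)) →
        pullback.snd f (X.fromSpecStalk x) s = closedPoint (X.presheaf.stalk x) := by
    intro s hs
    have h1 : pullback.fst f (X.fromSpecStalk x) s ∉ Scheme.regularLocus X' := fun h =>
      hs ((mem_regularLocus_iff_pullback_fst_fromSpecStalk f x s).mpr h)
    have h2 : f (pullback.fst f (X.fromSpecStalk x) s) ∈ (C : Set X) := by
      by_contra h
      exact h1 (hreg _ h)
    have h3 : X.fromSpecStalk x (pullback.snd f (X.fromSpecStalk x) s) ⤳ x :=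
      Scheme.range_fromSpecStalk.le ⟨_, rfl⟩
    have h4 : X.fromSpecStalk x (pullback.snd f (X.fromSpecStalk x) s) = x :=
      hmax _ (hfj s ▸ h2) h3
    apply (X.fromSpecStalk x).isEmbedding.injective
    rw [h4, Scheme.fromSpecStalk_closedPoint]
  -- the local desingularization provided by condition (iii)
  obtain ⟨S'', g', hdes⟩ := hloc x (fun h => (hCT hxC) h) (pullback f (X.fromSpecStalk x))
    (pullback.snd f (X.fromSpecStalk x)) (J.comap (X.fromSpecStalk x)) hgb hsing
  obtain ⟨I', hg', hI'⟩ := hdes.exists_isBlowup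
  have hS''reg := hdes.isRegular
  -- extend its centre to `X'` (Lemma 2.1.1) and blow `X'` up along the extension
  obtain ⟨J', hJ'I', hJ'supp⟩ := exists_idealSheaf_extension_fromSpecStalk f x I'
  obtain ⟨X'', f', hf'⟩ := exists_isBlowup X' J'
  -- the new centre lies over the closure of `x`, inside `C ⊆ T`
  have hIx : ∀ s ∈ (I'.support : Set ↑(pullback f (X.fromSpecStalk x))),
      f (pullback.fst f (X.fromSpecStalk x) s) = x := fun s hs => by
    rw [hfj, hsing s (hI' hs), Scheme.fromSpecStalk_closedPoint]
  have hJ'C : f '' (J'.support : Set X') ⊆ (C : Set X) := by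
    rw [hJ'supp]
    refine (image_closure_subset_closure_image f.continuous).trans ?_
    refine C.isClosed.closure_subset_iff.mpr ?_
    rintro _ ⟨_, ⟨s, hs, rfl⟩, rfl⟩
    rw [hIx s hs]
    exact hxC
  have hJ'T : (J'.support : Set X') ⊆ f ⁻¹' T := fun x' hx' => hCT (hJ'C ⟨x', hx', rfl⟩)
  -- so the composite is a `T`-supported blow-up of `X` (Lemma 2.1.4)
  obtain ⟨J₂, hf₂, hJ₂⟩ := hf.exists_isBlowup_comp_supported f J f' J' T hJ hf' hJ'T
  -- `X''` is of finite type over `k`: its singular locus is closed, with closed image `C'`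
  haveI : IsProper f' := hf'.isProper
  have hreg'' : IsClosed (Scheme.regularLocus X'')ᶜ :=
    isClosed_compl_regularLocus_of_locallyOfFiniteType ((f' ≫ f) ≫ f₀) hB
  let C' : Closeds X :=
    ⟨(f' ≫ f) '' (Scheme.regularLocus X'')ᶜ, (f' ≫ f).isClosedMap _ hreg''⟩
  -- `C' ⊆ C ∖ {x}`
  have hC'C : (C' : Set X) ⊆ (C : Set X) \ {x} := by
    rintro _ ⟨x'', hx'', rfl⟩
    refine ⟨?_, ?_⟩
    · -- over `X ∖ C`: `X'` is regular there and `f'` is an isomorphism off its centre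
      by_contra hy
      have hy' : f (f' x'') ∉ (C : Set X) := by rwa [Scheme.Hom.comp_apply] at hy
      have h1 : f' x'' ∈ Scheme.regularLocus X' := hreg _ hy'
      have h2 : f' x'' ∉ (J'.support : Set X') := fun h => hy' (hJ'C ⟨_, h, rfl⟩)
      haveI := hf'.isIso_compl
      exact hx'' ((mem_regularLocus_iff_of_isIso_morphismRestrict f'
        ⟨(J'.support : Set X')ᶜ, J'.support.isClosed.isOpen_compl⟩ x'' h2).mpr h1)
    · -- over `x`: `X'' ×_{X'} S'` is the regular scheme `S''` (flat base change, uniqueness)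
      intro hyx
      rw [Set.mem_singleton_iff, Scheme.Hom.comp_apply] at hyx
      obtain ⟨s, hs⟩ := mem_range_pullback_fst_fromSpecStalk_of_eq f x hyx
      have hT' : IsBlowup (pullback.snd f' (pullback.fst f (X.fromSpecStalk x))) I' := by
        rw [← hJ'I']
        exact hf'.pullback_snd_of_flat _
      obtain ⟨e, -, -⟩ := hT'.unique hg'
      have hx''range : x'' ∈ Set.range (pullback.fst f' (pullback.fst f (X.fromSpecStalk x))) := by
        rw [Scheme.Pullback.range_fst]
        exact ⟨s, hs⟩
      obtain ⟨t, rfl⟩ := hx''range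
      apply hx''
      refine (mem_regularLocus_iff_of_flat_of_isPreimmersion _ t).mp ?_
      exact (mem_regularLocus_iff_of_flat_of_isPreimmersion e.hom t).mpr (hS''reg _)
  have hlt : C' < C := by
    refine lt_of_le_of_ne (fun y hy => (hC'C hy).1) fun h => ?_
    have hx' : x ∈ (C' : Set X) := by
      rw [h]
      exact hxC
    exact (hC'C hx').2 rfl
  exact ih C' hlt (fun y hy => hCT (hC'C hy).1)
    ⟨X'', f' ≫ f, J₂, hf₂, hJ₂, fun x'' hx'' => by
      by_contra h
      exact hx'' ⟨x'', h, rfl⟩⟩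

/-! ## H3b — factoring one blow-up through another -/

/-- **Factoring one blow-up through another.** If `σ : Z → X` is a blow-up along `Q` pulling `J`
back to an effective Cartier ideal and `r : S₁ → X` is a blow-up along `J`, then some `t : Z → S₁`
with `t ≫ r = σ` is a blow-up of `S₁` along `Q𝒪_{S₁}`: by Stacks 080A twice, `Bl_{Q𝒪} S₁ → X` and
`Z = Bl_{J𝒪} Z → X` are both blow-ups along `J · Q`, hence isomorphic over `X`.
[cite: StacksProject, Tag 080A] -/
theorem exists_isBlowup_factor {Z S₁ X : Scheme.{u}} {σ : Z ⟶ X} {r : S₁ ⟶ X}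
    {Q J : X.IdealSheafData} (hσ : IsBlowup σ Q) (hr : IsBlowup r J)
    (hJ : IsEffectiveCartier (J.comap σ)) :
    ∃ t : Z ⟶ S₁, IsBlowup t (Q.comap r) ∧ t ≫ r = σ := by
  obtain ⟨B, t', ht'⟩ := exists_isBlowup S₁ (Q.comap r)
  have h1 : IsBlowup (t' ≫ r) (J * Q) := hr.comp ht'
  have h2 : IsBlowup (𝟙 Z ≫ σ) (Q * J) := hσ.comp (IsBlowup.id hJ)
  rw [Category.id_comp, mul_comm] at h2
  obtain ⟨e, he, -⟩ := h2.unique h1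
  exact ⟨e.hom ≫ t', ht'.iso_comp e, by rw [Category.assoc, he]⟩

/-! ## H4a — excellence of finite-type schemes over excellent rings and of stalks over fields -/

/-- **Schemes locally of finite type over an excellent ring are excellent**: every affine open has
a coordinate ring of finite type over `A` (same proof as the in-tree
`Scheme.isQuasiExcellent_of_locallyOfFiniteType_of_isQuasiExcellentRing`, with
`IsExcellentRing.of_finiteType'`). [folklore] -/
theorem isExcellent_of_locallyOfFiniteType_of_isExcellentRing {A : Type u} [CommRing A]
    (hA : IsExcellentRing A) {X : Scheme.{u}} (f : X ⟶ Spec (.of A)) [LocallyOfFiniteType f] :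
    Scheme.IsExcellent X := by
  intro U
  have hφ : RingHom.FiniteType (f.appLE ⊤ (U : X.Opens) le_top).hom :=
    HasRingHomProperty.appLE @LocallyOfFiniteType f ‹_› ⟨⊤, isAffineOpen_top _⟩ U le_top
  let e : A ≃+* Γ(Spec (.of A), ⊤) := (Scheme.ΓSpecIso (.of A)).commRingCatIsoToRingEquiv.symm
  have hψ : RingHom.FiniteType
      (((f.appLE ⊤ (U : X.Opens) le_top).hom : _ →+* _).comp e.toRingHom) :=
    hφ.comp (RingHom.FiniteType.of_surjective _ e.surjective)
  letI : Algebra A Γ(X, U) :=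
    ((((f.appLE ⊤ (U : X.Opens) le_top).hom : _ →+* _).comp e.toRingHom)).toAlgebra
  haveI : Algebra.FiniteType A Γ(X, U) := hψ
  exact hA.of_finiteType'

/-- **Stalks of schemes locally of finite type over a field are excellent**: the stalk at `x` is a
localization of the coordinate ring of an affine neighbourhood, which is of finite type over the
field, hence excellent (`isExcellentRing_of_finiteType_field`), and excellence localizes
(`IsExcellentRing.of_isLocalization`). [folklore] -/
theorem isExcellentRing_stalk {k : Type u} [Field k] {X : Scheme.{u}} (f : X ⟶ Spec (.of k))
    [LocallyOfFiniteType f] (x : X) : IsExcellentRing (X.presheaf.stalk x) := by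
  obtain ⟨V, hV, hxV, -⟩ :=
    exists_isAffineOpen_mem_and_subset (X := X) (x := x) (U := f ⁻¹ᵁ ⊤) (by simp)
  have hφ : RingHom.FiniteType (f.appLE ⊤ V le_top).hom :=
    HasRingHomProperty.appLE @LocallyOfFiniteType f ‹_› ⟨⊤, isAffineOpen_top _⟩ ⟨V, hV⟩ le_top
  let e : k ≃+* Γ(Spec (.of k), ⊤) := (Scheme.ΓSpecIso (.of k)).commRingCatIsoToRingEquiv.symm
  have hψ : RingHom.FiniteType (((f.appLE ⊤ V le_top).hom : _ →+* _).comp e.toRingHom) :=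
    hφ.comp (RingHom.FiniteType.of_surjective _ e.surjective)
  have hΓV : IsExcellentRing Γ(X, V) := by
    letI : Algebra k Γ(X, V) := ((((f.appLE ⊤ V le_top).hom : _ →+* _).comp e.toRingHom)).toAlgebra
    haveI : Algebra.FiniteType k Γ(X, V) := hψ
    exact isExcellentRing_of_finiteType_field k Γ(X, V)
  letI : Algebra Γ(X, V) (X.presheaf.stalk x) :=
    TopCat.Presheaf.algebra_section_stalk X.presheaf (⟨x, hxV⟩ : V)
  have hloc : IsLocalization.AtPrime (X.presheaf.stalk x) (hV.primeIdealOf ⟨x, hxV⟩).asIdeal :=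
    hV.isLocalization_stalk ⟨x, hxV⟩
  exact hΓV.of_isLocalization (hV.primeIdealOf ⟨x, hxV⟩).asIdeal.primeCompl

/-- `¬ d ≤ 2 → 3 ≤ d` in `WithBot ℕ∞`. [folklore] -/
theorem three_le_of_not_le_two {d : WithBot ℕ∞} (h : ¬ d ≤ 2) : 3 ≤ d := by
  induction d using WithBot.recBotCoe with
  | bot => exact absurd bot_le h
  | coe n =>
    have h' : ¬ n ≤ 2 := fun hn => h (WithBot.coe_le_coe.mpr hn)
    have h3 : (3 : ℕ∞) ≤ n := by
      have h23 : (3 : ℕ∞) = 2 + 1 := by norm_num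
      rw [h23]
      exact Order.add_one_le_of_lt (not_le.mp h')
    exact WithBot.coe_le_coe.mpr h3

/-- `¬ 4 ≤ d → d ≤ 3` in `WithBot ℕ∞`. [folklore] -/
theorem le_three_of_not_four_le {d : WithBot ℕ∞} (h4 : ¬ 4 ≤ d) : d ≤ 3 := by
  have h := not_le.mp h4
  induction d using WithBot.recBotCoe with
  | bot => exact bot_le
  | coe n =>
    have h' : n < 4 := WithBot.coe_lt_coe.mp h
    have h3 : n ≤ 3 := by
      have h34 : (4 : ℕ∞) = 3 + 1 := by norm_num
      rw [h34] at h'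
      exact Order.le_of_lt_add_one h'
    exact WithBot.coe_le_coe.mpr h3

/-! ## Registered universe-`0` forms (stubs of the crux item, for the line's skeleton) -/

/-- **Temkin's localisation per scheme over a field** (registered helper stub
`admitsDesingularization_of_localBlowups_over_field` of stmt-ResolutionOfSingularities-0554): the
universe-`0` instance of `admitsDesingularization_of_localBlowups` over `B = Spec k`, `k` a field
(Noetherian and quasi-excellent, `Stacks07QU_holds`, `isQuasiExcellentRing_of_field`).
[cite: Temkin2008, Prop. 2.3.4] -/
theorem admitsDesingularization_of_localBlowups_over_field : ∀ (k : Type) [Field k] (X : Scheme.{0}) [IsIntegral X] (f : X ⟶ Spec (.of k)) [LocallyOfFiniteType f] [QuasiCompact f], (∀ x : X, x ∉ Scheme.regularLocus X → ∀ (S' : Scheme.{0}) (g : S' ⟶ Spec (X.presheaf.stalk x)) (I : (Spec (X.presheaf.stalk x)).IdealSheafData), IsBlowup g I → (∀ s : S', s ∉ Scheme.regularLocus S' → g s = IsLocalRing.closedPoint (X.presheaf.stalk x)) → Scheme.AdmitsDesingularization S') → Scheme.AdmitsDesingularization X := by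
  intro k _ X _ f _ _ hloc
  haveI : IsNoetherianRing (CommRingCat.of k) := inferInstanceAs (IsNoetherianRing k)
  haveI : IsNoetherian (Spec (CommRingCat.of k)) := {}
  have hqe : Scheme.IsQuasiExcellent (Spec (CommRingCat.of k)) :=
    Scheme.isQuasiExcellent_of_locallyOfFiniteType_of_isQuasiExcellentRing Stacks07QU_holds
      (isQuasiExcellentRing_of_field k) (𝟙 _)
  exact admitsDesingularization_of_localBlowups hqe f hloc

/-- **Stalks of schemes locally of finite type over a field are excellent** (registered helper
stub `isExcellentRing_stalk_of_locallyOfFiniteType` of stmt-ResolutionOfSingularities-0554; the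
universe-`0` instance of `isExcellentRing_stalk`). [folklore] -/
theorem isExcellentRing_stalk_of_locallyOfFiniteType : ∀ (k : Type) [Field k] (X : Scheme.{0}) (f : X ⟶ Spec (.of k)) [LocallyOfFiniteType f] (x : X), IsExcellentRing (X.presheaf.stalk x) :=
  fun _ _ _ f _ x => isExcellentRing_stalk f x

end Summit.ResolutionOfSingularities.ResolutionOfSingularities.Theorems.Picover.LocalBlowups

end
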